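import Literature.Geometry.Symplectic.JHolomorphicDiscMaximumPrinciple
import Literature.Analysis.Pluripotential.HopfLemmaSubharmonic
import HarnessLib

/-!
# `J`-holomorphic discs meet the `J`-convex boundary transversally (Eliashberg 1990, §1.1)

Topic `Literature/Geometry/Symplectic`; proofs file of the fact seat of
`Literature.Geometry.Symplectic.Eliashberg1990_steinFilling_sphere_three` (Eliashberg (1990),
*Filling by holomorphic discs*, Thm. 5.1).  Eliashberg, §1.1 (held copy read), on a domain `Ω`
with smooth `J`-convex boundary and a `J`-holomorphic curve `C` with `∂C ⊂ ∂Ω`: *"Moreover, `C`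
is transversal to `∂Ω` in all regular points of its boundary `∂C`."*

For the tree's objects: `S` a Stein structure on the compact `W` (`SteinDomain.lean`),
`u : ℂ → W` smooth on an open `V ⊇ D̄(c, R)` and `J`-holomorphic on the open disc `D(c, R)`
(`Literature.Geometry.Symplectic.IsJHolomorphicOn`, `JHolomorphicOn.lean`), not constant on the
disc, and a boundary point `p ∈ ∂D(c, R)` of the disc with `u p ∈ ∂W`.  Then

* `SteinStructure.pos_fderiv_φ_comp_disc` — **`D(φ ∘ u)(p)(p - c) > 0`**: the radial derivative
  of `φ ∘ u` at `p` is strictly positive.  (`φ ∘ u` is `C²` near the closed disc with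
  `Δ(φ ∘ u) ≥ 0` on the open disc — the local Levi identity,
  `IsJHolomorphicOn.laplacian_comp_nonneg` — and `φ ∘ u < max φ = φ(u p)` on the open disc, because
  the disc, not being constant, lies in `Int W` by the disc maximum principle
  `SteinStructure.isInteriorPoint_of_isJHolomorphicOn`; E. Hopf's boundary point lemma
  `Literature.Analysis.Pluripotential.pos_fderiv_of_laplacian_nonneg_of_lt` concludes.)
* `SteinStructure.pos_dφ_mfderiv_disc` — equivalently `dφ_{u p}(du_p(p - c)) > 0`: the velocity
  of the disc along the outward radius is **transverse to `∂W = {φ = max φ}` and points outward**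
  (`T∂W = ker dφ`);
* `SteinStructure.mfderiv_ne_zero_disc` — in particular `du_p ≠ 0`: boundary points of the disc
  on `∂W` are automatically regular points (so "in all regular points" is not a restriction here).

Everything is proved; no definition, no named fact.

## References

* Ya. Eliashberg, *Filling by holomorphic discs and its applications*, LMS Lecture Note Ser. 151
  (1990), 45–67, §1.1. [Eliashberg1990]
* D. Gilbarg, N. S. Trudinger, *Elliptic Partial Differential Equations of Second Order*,
  Lemma 3.4 (Hopf). [GilbargTrudinger2001]
-/

noncomputable section

open scoped Manifold ContDiff Topology
open Set Filter Metric

namespace Literature.Geometry.Symplectic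

open Literature.Geometry.Kaehler

namespace SteinStructure

variable {W : Type*} [TopologicalSpace W] [ChartedSpace (EuclideanHalfSpace 4) W]
  [IsManifold (𝓡∂ 4) ∞ W] [T2Space W] [CompactSpace W] {u : ℂ → W} {V : Set ℂ}

/-- **The radial derivative of `φ ∘ u` at a boundary point of a disc on `∂W` is positive.**
Let `S` be a Stein structure on the compact `W`, `u : ℂ → W` smooth on an open `V ⊇ D̄(c, R)`
(`R > 0`) and `J`-holomorphic on `D(c, R)`, taking two distinct values on `D(c, R)`, and
`p ∈ ∂D(c, R)` with `u p ∈ ∂W`.  Then `D(φ ∘ u)(p)(p - c) > 0` (Hopf's lemma applied to the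
subharmonic `φ ∘ u`, which is `< max φ = φ(u p)` on the open disc by the disc maximum
principle). [cite: Eliashberg1990, §1.1] [cite: GilbargTrudinger2001, Lemma 3.4] -/
theorem pos_fderiv_φ_comp_disc (S : SteinStructure W) (hV : IsOpen V)
    (hu : ∀ w ∈ V, ContMDiffAt 𝓘(ℝ, ℂ) (𝓡∂ 4) ∞ u w) {c : ℂ} {R : ℝ} (hR : 0 < R)
    (hcl : closedBall c R ⊆ V) (hJ : IsJHolomorphicOn (𝓡∂ 4) S.J u (ball c R))
    (hnc : ∃ a ∈ ball c R, ∃ b ∈ ball c R, u a ≠ u b) {p : ℂ} (hp : p ∈ sphere c R)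
    (hbp : (𝓡∂ 4).IsBoundaryPoint (u p)) :
    0 < fderiv ℝ (S.φ ∘ u) p (p - c) := by
  have hballV : ball c R ⊆ V := ball_subset_closedBall.trans hcl
  have hu' : ∀ w ∈ ball c R, ContMDiffAt 𝓘(ℝ, ℂ) (𝓡∂ 4) ∞ u w := fun w hw => hu w (hballV hw)
  -- `φ ∘ u` is `C²` on `V`
  have hG : ContDiffOn ℝ 2 (S.φ ∘ u) V := fun w hw =>
    ((contMDiffAt_iff_contDiffAt.1 ((S.φ_smooth (u w)).comp w (hu w hw))).of_le
      (by norm_cast)).contDiffWithinAt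
  -- `Δ(φ ∘ u) ≥ 0` on the open disc
  have hΔ : ∀ z ∈ ball c R, 0 ≤ fderiv ℝ (fderiv ℝ (S.φ ∘ u)) z 1 1 +
      fderiv ℝ (fderiv ℝ (S.φ ∘ u)) z Complex.I Complex.I := by
    intro z hz
    have hconv : ∀ v : EuclideanSpace ℝ (Fin 4),
        0 ≤ -(mextDeriv (dComplex S.J S.φ) (u z) ![v, S.J (u z) v]) := by
      intro v
      by_cases hv : v = 0
      · subst hv
        rw [map_zero, (mextDeriv (dComplex S.J S.φ) (u z)).map_coord_zero (0 : Fin 2) rfl,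
          neg_zero]
      · exact (S.convex (u z) v hv).le
    have h := hJ.laplacian_comp_nonneg S.preservesSmoothFields S.φ_smooth isOpen_ball hu' hz
      hconv (1 : ℂ)
    rwa [mul_one] at h
  -- `φ ∘ u < φ (u p) = max φ` on the open disc: the non-constant disc lies in `Int W`
  have hmaxval : S.φ (u p) = sSup (range S.φ) := (S.boundary_eq (u p)).1 hbp
  have hlt : ∀ z ∈ ball c R, (S.φ ∘ u) z < (S.φ ∘ u) p := by
    intro z hz
    have hint : (𝓡∂ 4).IsInteriorPoint (u z) :=
      S.isInteriorPoint_of_isJHolomorphicOn isOpen_ball (convex_ball c R).isPreconnected hu' hJ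
        hnc hz
    show S.φ (u z) < S.φ (u p)
    rw [hmaxval]
    exact (S.isInteriorPoint_iff_φ_lt (u z)).1 hint
  exact Literature.Analysis.Pluripotential.pos_fderiv_of_laplacian_nonneg_of_lt hV hG hR hcl hΔ
    hp hlt

/-- **Transversality** (Eliashberg (1990), §1.1: *"`C` is transversal to `∂Ω` in all regular
points of its boundary `∂C`"*): with `S`, `u`, `c`, `R`, `p` as in `pos_fderiv_φ_comp_disc`,
`dφ_{u p}(du_p(p - c)) > 0` — the image under `du_p` of the outward radial vector is transverse
to `∂W = {φ = max φ}` (whose tangent space is `ker dφ`) and points outward.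
[cite: Eliashberg1990, §1.1] -/
theorem pos_dφ_mfderiv_disc (S : SteinStructure W) (hV : IsOpen V)
    (hu : ∀ w ∈ V, ContMDiffAt 𝓘(ℝ, ℂ) (𝓡∂ 4) ∞ u w) {c : ℂ} {R : ℝ} (hR : 0 < R)
    (hcl : closedBall c R ⊆ V) (hJ : IsJHolomorphicOn (𝓡∂ 4) S.J u (ball c R))
    (hnc : ∃ a ∈ ball c R, ∃ b ∈ ball c R, u a ≠ u b) {p : ℂ} (hp : p ∈ sphere c R)
    (hbp : (𝓡∂ 4).IsBoundaryPoint (u p)) :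
    (0 : ℝ) < (mfderiv (𝓡∂ 4) 𝓘(ℝ, ℝ) S.φ (u p) : EuclideanSpace ℝ (Fin 4) →L[ℝ] ℝ)
      (mfderiv 𝓘(ℝ, ℂ) (𝓡∂ 4) u p (p - c)) := by
  have h := S.pos_fderiv_φ_comp_disc hV hu hR hcl hJ hnc hp hbp
  have hpV : p ∈ V := hcl (sphere_subset_closedBall hp)
  have hφd : MDifferentiableAt (𝓡∂ 4) 𝓘(ℝ, ℝ) S.φ (u p) := (S.φ_smooth (u p)).mdifferentiableAt (by simp)
  have hud : MDifferentiableAt 𝓘(ℝ, ℂ) (𝓡∂ 4) u p := (hu p hpV).mdifferentiableAt (by simp)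
  rw [← mfderiv_eq_fderiv, mfderiv_comp p hφd hud] at h
  exact h

/-- **Boundary points of the disc on `∂W` are regular points**: with `S`, `u`, `c`, `R`, `p` as
above, `du_p ≠ 0`. [cite: Eliashberg1990, §1.1] -/
theorem mfderiv_ne_zero_disc (S : SteinStructure W) (hV : IsOpen V)
    (hu : ∀ w ∈ V, ContMDiffAt 𝓘(ℝ, ℂ) (𝓡∂ 4) ∞ u w) {c : ℂ} {R : ℝ} (hR : 0 < R)
    (hcl : closedBall c R ⊆ V) (hJ : IsJHolomorphicOn (𝓡∂ 4) S.J u (ball c R))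
    (hnc : ∃ a ∈ ball c R, ∃ b ∈ ball c R, u a ≠ u b) {p : ℂ} (hp : p ∈ sphere c R)
    (hbp : (𝓡∂ 4).IsBoundaryPoint (u p)) :
    mfderiv 𝓘(ℝ, ℂ) (𝓡∂ 4) u p ≠ 0 := by
  intro h0
  have h := S.pos_dφ_mfderiv_disc hV hu hR hcl hJ hnc hp hbp
  rw [h0, zero_apply, map_zero] at h
  exact lt_irrefl _ h

end SteinStructure

end Literature.Geometry.Symplectic
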